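import Mathlib
import Literature.MathematicalPhysics.QuantumFieldTheory.Balaban1983to89.B13
import Summits.QuantumFields.BalabanUV.Beta.CutoffVariant316

/-!
# Beta / CutoffMayer332 — BINDER-OWNERS row D4, co-owner road P2′: the CUT-OFF TERM of [Balaban1988Convergent] (3.30) —
# (3.32)'s «only one characteristic function in the product is differentiated», the Mayer expansion of the product of
# cut-off functions ([II] (2.3) p. 12 shape), the (2.22)-type domination of its P-bond terms, the smallness bookkeeping
# into the road's budget, and the one-bond Gaussian quadratic exponential moment — abstract kernel form
# (β sub-cell, unit `b2b-balaban-beta-d4-p2`, generation 1; leaves χ.2/χ.3 of `HOME/beta/skeletons/D4-b2b-balaban-beta-d4-p2.md`)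

HONEST FRAMING (page 1 of everything the β sub-cell writes): discharging `BetaPertH` makes Bałaban's UV stability
UNCONDITIONAL — a real constructive-QFT result; it is NOT the continuum limit and NOT the Clay problem.  HONEST DEPENDENCY
(cell reorg 2026-08-19, verbatim): «continuum YM on T⁴ ⇐ BetaPertH ∧ nine spine estimates (0/9 proved); BetaPertH ⇐ (D1) ∧
(D4) ∧ CAP+tail; G-an2-4 gates asym, D1 and NE2/3/4.»  THIS MODULE INSTANTIATES NO BINDER AND ASSERTS NOTHING ABOUT
BAŁABAN'S INTEGRALS: finite algebra (Leibniz rule and the Mayer expansion of a finite product), real inequalities (the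
tree's certified (2.22) `B13.indicator_le_exp_222` BY NAME, products, powers), one Bochner-integral monotonicity on a
finite measure space, and one explicit Gaussian integral from Mathlib (`integral_gaussian`); the polymer-activity input of
the cut-off gas (the decoupling/random-walk step (I.7.3), skeleton χ.4 = road P1's (T1)-type residue) is NOT typed and is
named as such.

ABSOLUTE RULE (cell charter, verbatim): "No internally-minted statement may enter as a cited fact. Every hypothesis is
either kernel-proved in this package or a verbatim quotation of a PUBLISHED theorem with page reference. The manuscript(s)
under audit are NOT citable for their own disputed steps — they are the thing under adjudication; programme-internal
(2001/route/tribunal) claims are never citable."  Nothing is cited as a fact here.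

## The printed text and what is typed

[III] = [Balaban1988Convergent], CMP **119** (1988).  p. 273 after (3.31) (text layer read by this seat): *«Consider the
second logarithm on the right-hand side of (3.30). Denote the characteristic function with the parameter t multiplying the
variables A by χ_t^{(k)}. Thus there is the function χ_1^{(k)} in this expression, and χ_0^{(k)} ≡ 1. We have
log∫dμ_{C^{(k)}(Λ_{k+1})}χ^{(k)} = ∫₀¹dt ⟨(d/dt)χ_t^{(k)}⟩… (3.32) and (d/dt)χ_t^{(k)} can be written as a sum of terms, for
which only one characteristic function in the product is differentiated.»*  p. 278 ll. 19–27: *«The second integral on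
the right-hand side of (3.37) is treated in the same way as above, but it is simpler because there is only the Gaussian
action. Thus we start with the expansion (1.7.3), taken with Y₀ = ∅, for the denominator, and with this expansion taken with
Y₀ = □, □ is the cube containing b, for the nominator. Next we repeat the steps from (1.7.3) to (1.7.13), and the above from
(3.44) to (3.47). We obtain an expansion of the form (3.47), with terms satisfying the bounds (1.1.18).»*  [II] =
[Balaban1988RG2Cluster] (2.3) p. 12 expands the product of the complementary characteristic functions over bond sets P,
and (2.22) p. 16 dominates each large-field indicator by `exp(½γ₂(|B(b)|² − ε₁²g_k⁻²))` (tree: `B13.indicator_le_exp_222`,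
certified).

TYPED HERE (abstract: a finite set `B` of bonds, cut-off factors `χ_b = 1 − θ_b`, any finite measure space for the
fluctuation integral):
* §1 `hasDerivAt_prod_cutoff` — (3.32)'s sentence: `d/dt Π_{b∈B} χ_b(t) = Σ_{b∈B} (Π_{b′≠b} χ_{b′}(t))·χ_b′(t)` (Mathlib's
  `HasDerivAt.fun_finsetProd`; for differentiable-in-t cut-offs — the sharp ones of (3.32) are the reader-level limit, GAPS
  C-adv5-22; `CutoffTail332` typed the resulting Gaussian tail).
* §2 `prod_one_sub_eq_sum` — the Mayer expansion of the product of cut-off functions `Π_{b∈B}(1 − θ_b) =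
  Σ_{P⊆B}(−1)^{|P|}Π_{b∈P}θ_b` ([II] (2.3) shape; = (I.7.3) «taken with Y₀ = ∅» before decoupling) and its marked form
  `marked_prod_one_sub_eq_sum` (one factor replaced by its derivative: «Y₀ = □, the cube containing b»).
* §3 `prod_le_exp_of_support` — (2.22)-type domination of a P-term: factors `0 ≤ θ_b ≤ 1` supported in `{r ≤ |x_b|}` give
  `Π_{b∈P}θ_b ≤ e^{−½γ₂r²|P|}·exp(½γ₂Σ_{b∈P}x_b²)`; the sharp case `prod_indicator_le_exp` is `B13.indicator_le_exp_222`
  factor by factor.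
* §4 `integral_prod_le` — integrating §3 on a finite measure space against a displayed exponential-moment hypothesis
  `∫exp(½γ₂Σ_{b∈P}x_b²)dμ ≤ Mom`: `∫Π_{b∈P}θ_b dμ ≤ e^{−½γ₂r²|P|}·Mom` — the smallness `e^{−½γ₂r²}` PER LARGE-FIELD BOND.
* §5 `pow_mul_le_of_card_pos` + `activity_le_budget_term` — bookkeeping into the road's budget: an activity
  `≤ (M·e^{−½γ₂r²})^n·D` with `n ≥ 1` large-field bonds and `M·e^{−½γ₂r²} ≤ 1` is `≤ M·e^{−½γ₂r²}·D`, and at the road's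
  cut-off radius `r = r(g) = A₁(log g⁻²)^{p₀}` ((3.16)) `e^{−½γ₂ r(g)²} ≤ g^m` for `g ≤ γ_T` (`CutoffVariant316.cutoffTail_le_pow`
  BY NAME) — the `cχ·e^{−λr²}` summand of `CutoffVariant316.budget`, smaller than any power of g.
* §6 `integral_exp_mul_sq_gaussianReal` — the one-bond engine for the moment constant: for the centred real Gaussian of
  variance `v > 0` and `κ < 1/(2v)`, `∫e^{κx²}dN(0,v) = (1 − 2κv)^{−1/2}` ([III] p. 273 uses the spectral bound of the
  covariance, `v ≤ λ₀⁻¹`; the correlated many-bond moment is the decoupling step χ.4, NOT typed).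
NOT CLAIMED: the polymer representation (I.7.3)–(I.7.13) of the Gaussian cut-off integrals (χ.4), anything of `BetaPertH`;
NOT continuum, NOT Clay.
-/

namespace Summit.QuantumFields.BalabanUV.Beta.CutoffMayer332

open Finset MeasureTheory ProbabilityTheory Filter
open Literature.MathematicalPhysics.QuantumFieldTheory.Balaban1983to89
open Literature.MathematicalPhysics.QuantumFieldTheory.Balaban1983to89.B13 (indicator_le_exp_222)
open Summit.QuantumFields.BalabanUV.Beta.CutoffVariant316

noncomputable section

/-! ## §1 (3.32): one cut-off factor differentiated at a time (Leibniz) -/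

/-- **(3.32), the sentence after it**: the t-derivative of the product of (t-differentiable) cut-off factors is the sum
over bonds of the product with exactly that factor differentiated. -/
theorem hasDerivAt_prod_cutoff {β : Type*} [DecidableEq β] (B : Finset β) {χ : β → ℝ → ℝ} {χ' : β → ℝ} {t : ℝ}
    (h : ∀ b ∈ B, HasDerivAt (χ b) (χ' b) t) :
    HasDerivAt (fun s => ∏ b ∈ B, χ b s) (∑ b ∈ B, (∏ b' ∈ B.erase b, χ b' t) * χ' b) t := by
  have := HasDerivAt.fun_finsetProd (u := B) (f := χ) (f' := χ') h
  simpa only [smul_eq_mul] using this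

/-! ## §2 The Mayer expansion of the product of cut-off functions ([II] (2.3) shape) -/

/-- `Π_{b∈B}(1 − θ_b) = Σ_{P⊆B} (−1)^{|P|} Π_{b∈P} θ_b` in any commutative ring. -/
theorem prod_one_sub_eq_sum {β R : Type*} [CommRing R] (B : Finset β) (θ : β → R) :
    ∏ b ∈ B, (1 - θ b) = ∑ P ∈ B.powerset, (-1) ^ P.card * ∏ b ∈ P, θ b := by
  have h : ∀ b ∈ B, (1 - θ b) = 1 + (-θ b) := fun b _ => sub_eq_add_neg 1 (θ b)
  rw [prod_congr rfl h, prod_one_add]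
  exact sum_congr rfl fun P _ => prod_neg θ

/-- **Marked form** («Y₀ = □, the cube containing b»): with the factor of the marked bond `b` replaced by `ψ` (its
t-derivative in (3.32)), `ψ · Π_{b′∈B∖b}(1 − θ_{b′}) = Σ_{P ⊆ B∖b} (−1)^{|P|} ψ · Π_{b′∈P} θ_{b′}`. -/
theorem marked_prod_one_sub_eq_sum {β R : Type*} [DecidableEq β] [CommRing R] (B : Finset β) (b : β) (θ : β → R)
    (ψ : R) :
    ψ * ∏ b' ∈ B.erase b, (1 - θ b') = ∑ P ∈ (B.erase b).powerset, (-1) ^ P.card * (ψ * ∏ b' ∈ P, θ b') := by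
  rw [prod_one_sub_eq_sum, mul_sum]
  exact sum_congr rfl fun P _ => by ring

/-- The derivative of §1 in Mayer-expanded form: `Σ_b (Π_{b′≠b}(1 − θ_{b′}))·ψ_b = Σ_b Σ_{P⊆B∖b} (−1)^{|P|} ψ_b Π_{P} θ`. -/
theorem deriv_prod_eq_marked_sum {β R : Type*} [DecidableEq β] [CommRing R] (B : Finset β) (θ ψ : β → R) :
    ∑ b ∈ B, (∏ b' ∈ B.erase b, (1 - θ b')) * ψ b =
      ∑ b ∈ B, ∑ P ∈ (B.erase b).powerset, (-1) ^ P.card * (ψ b * ∏ b' ∈ P, θ b') :=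
  sum_congr rfl fun b _ => by rw [mul_comm, marked_prod_one_sub_eq_sum]

/-! ## §3 (2.22)-type domination of the P-bond terms -/

/-- One factor: `θ ≤ 1` supported in `{r ≤ |x|}` is `≤ exp(½γ₂(x² − r²))` (γ₂, r ≥ 0). -/
theorem le_exp_of_support {θ x r γ₂ : ℝ} (hγ : 0 ≤ γ₂) (hr : 0 ≤ r) (h1 : θ ≤ 1)
    (hs : θ ≠ 0 → r ≤ |x|) : θ ≤ Real.exp (γ₂ / 2 * (x ^ 2 - r ^ 2)) := by
  by_cases hθ : θ = 0
  · rw [hθ]; exact (Real.exp_pos _).le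
  · have hind := indicator_le_exp_222 x r γ₂ hγ hr
    rw [if_pos (hs hθ)] at hind
    exact h1.trans hind

/-- **P-term domination**: `Π_{b∈P} θ_b ≤ e^{−½γ₂ r²|P|} · exp(½γ₂ Σ_{b∈P} x_b²)` for factors as in `le_exp_of_support`. -/
theorem prod_le_exp_of_support {β : Type*} (P : Finset β) (θ x : β → ℝ) {r γ₂ : ℝ} (hγ : 0 ≤ γ₂) (hr : 0 ≤ r)
    (h0 : ∀ b ∈ P, 0 ≤ θ b) (h1 : ∀ b ∈ P, θ b ≤ 1) (hs : ∀ b ∈ P, θ b ≠ 0 → r ≤ |x b|) :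
    ∏ b ∈ P, θ b ≤ Real.exp (-(γ₂ / 2 * r ^ 2 * P.card)) * Real.exp (γ₂ / 2 * ∑ b ∈ P, x b ^ 2) := by
  calc ∏ b ∈ P, θ b ≤ ∏ b ∈ P, Real.exp (γ₂ / 2 * (x b ^ 2 - r ^ 2)) :=
        prod_le_prod h0 fun b hb => le_exp_of_support hγ hr (h1 b hb) (hs b hb)
    _ = Real.exp (-(γ₂ / 2 * r ^ 2 * P.card)) * Real.exp (γ₂ / 2 * ∑ b ∈ P, x b ^ 2) := by
        rw [← Real.exp_sum, ← Real.exp_add]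
        congr 1
        have hsum : ∑ b ∈ P, γ₂ / 2 * (x b ^ 2 - r ^ 2) =
            ∑ b ∈ P, γ₂ / 2 * x b ^ 2 - ∑ b ∈ P, γ₂ / 2 * r ^ 2 := by
          rw [← sum_sub_distrib]; exact sum_congr rfl fun b _ => by ring
        rw [hsum, sum_const, nsmul_eq_mul, mul_sum]; ring

/-- The sharp case, literally `B13.indicator_le_exp_222` factor by factor ([II] (2.22) p. 16):
`Π_{b∈P} 1[r ≤ |x_b|] ≤ e^{−½γ₂r²|P|}·exp(½γ₂Σ_{b∈P}x_b²)`. -/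
theorem prod_indicator_le_exp {β : Type*} (P : Finset β) (x : β → ℝ) {r γ₂ : ℝ} (hγ : 0 ≤ γ₂) (hr : 0 ≤ r) :
    ∏ b ∈ P, (if r ≤ |x b| then (1 : ℝ) else 0) ≤
      Real.exp (-(γ₂ / 2 * r ^ 2 * P.card)) * Real.exp (γ₂ / 2 * ∑ b ∈ P, x b ^ 2) :=
  prod_le_exp_of_support P (fun b => if r ≤ |x b| then (1 : ℝ) else 0) x hγ hr
    (fun b _ => by split_ifs <;> norm_num) (fun b _ => by split_ifs <;> norm_num)
    (fun b _ h => by by_contra hc; exact h (if_neg hc))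

/-! ## §4 The integrated P-term: smallness `e^{−½γ₂r²}` per large-field bond -/

variable {Ω : Type*} [MeasurableSpace Ω]

/-- **Integrated domination**: on a finite measure space, for cut-off complements `θ_b(ω)` as in §3 (measurable) and an
exponential-moment bound `∫exp(½γ₂Σ_{b∈P}x_b(ω)²)dμ ≤ Mom` (displayed hypothesis — for Bałaban's Gaussian it is the
decoupling step χ.4), `∫Π_{b∈P}θ_b dμ ≤ e^{−½γ₂r²|P|}·Mom`. -/
theorem integral_prod_le (μ : Measure Ω) [IsFiniteMeasure μ] {β : Type*} (P : Finset β) (θ x : β → Ω → ℝ)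
    {r γ₂ Mom : ℝ} (hγ : 0 ≤ γ₂) (hr : 0 ≤ r)
    (h0 : ∀ b ∈ P, ∀ ω, 0 ≤ θ b ω) (h1 : ∀ b ∈ P, ∀ ω, θ b ω ≤ 1) (hs : ∀ b ∈ P, ∀ ω, θ b ω ≠ 0 → r ≤ |x b ω|)
    (hint : Integrable (fun ω => Real.exp (γ₂ / 2 * ∑ b ∈ P, x b ω ^ 2)) μ)
    (hmom : ∫ ω, Real.exp (γ₂ / 2 * ∑ b ∈ P, x b ω ^ 2) ∂μ ≤ Mom) :
    ∫ ω, ∏ b ∈ P, θ b ω ∂μ ≤ Real.exp (-(γ₂ / 2 * r ^ 2 * P.card)) * Mom := by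
  have hpt : ∀ ω, ∏ b ∈ P, θ b ω ≤
      Real.exp (-(γ₂ / 2 * r ^ 2 * P.card)) * Real.exp (γ₂ / 2 * ∑ b ∈ P, x b ω ^ 2) := fun ω =>
    prod_le_exp_of_support P (fun b => θ b ω) (fun b => x b ω) hγ hr (fun b hb => h0 b hb ω)
      (fun b hb => h1 b hb ω) (fun b hb => hs b hb ω)
  calc ∫ ω, ∏ b ∈ P, θ b ω ∂μ
      ≤ ∫ ω, Real.exp (-(γ₂ / 2 * r ^ 2 * P.card)) * Real.exp (γ₂ / 2 * ∑ b ∈ P, x b ω ^ 2) ∂μ := by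
        apply integral_mono_of_nonneg (Eventually.of_forall fun ω => prod_nonneg fun b hb => h0 b hb ω)
          (hint.const_mul _) (Eventually.of_forall hpt)
    _ = Real.exp (-(γ₂ / 2 * r ^ 2 * P.card)) * ∫ ω, Real.exp (γ₂ / 2 * ∑ b ∈ P, x b ω ^ 2) ∂μ :=
        integral_const_mul _ _
    _ ≤ Real.exp (-(γ₂ / 2 * r ^ 2 * P.card)) * Mom := mul_le_mul_of_nonneg_left hmom (Real.exp_pos _).le

/-! ## §5 Bookkeeping into the road's budget: one power of the per-bond smallness, then `≤ g^m` at the cut-off radius -/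

/-- `s^n·D ≤ s·D` for `0 ≤ s ≤ 1`, `n ≥ 1`, `D ≥ 0`: a polymer with `n ≥ 1` large-field bonds keeps ONE smallness factor. -/
theorem pow_mul_le_of_card_pos {s D : ℝ} {n : ℕ} (hs0 : 0 ≤ s) (hs1 : s ≤ 1) (hn : 1 ≤ n) (hD : 0 ≤ D) :
    s ^ n * D ≤ s * D := by
  apply mul_le_mul_of_nonneg_right _ hD
  calc s ^ n ≤ s ^ 1 := pow_le_pow_of_le_one hs0 hs1 hn
    _ = s := pow_one s

/-- **The cut-off term's activity enters the budget as `M·g^m·D`**: an activity bounded by `(M e^{−½γ₂ r(g)²})^n · D` with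
`n ≥ 1` large-field bonds, at the road's cut-off radius `r(g) = p0Profile A₁ p₀ g = A₁(log g⁻²)^{p₀}` ((3.16)), is
`≤ M·g^m·D` once `0 < g ≤ γ_T(½γ₂, A₁, p₀, m)` (`CutoffVariant316.cutoffTail_le_pow`) and `M·g^m ≤ 1` — GAPS C-adv5-22's
«E₀-free and smaller than any power of g_k», with the threshold explicit. -/
theorem activity_le_budget_term {a M D γ₂ A₁ g : ℝ} {p₀ m n : ℕ} (hγ : 0 < γ₂) (hA₁ : 0 < A₁) (hp₀ : 1 ≤ p₀)
    (hM : 0 ≤ M) (hD : 0 ≤ D) (hn : 1 ≤ n) (hg : 0 < g) (hgT : g ≤ gammaT (γ₂ / 2) A₁ p₀ m) (hMg : M * g ^ m ≤ 1)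
    (ha : a ≤ (M * Real.exp (-(γ₂ / 2) * p0Profile A₁ p₀ g ^ 2)) ^ n * D) : a ≤ M * g ^ m * D := by
  have htail : Real.exp (-(γ₂ / 2) * p0Profile A₁ p₀ g ^ 2) ≤ g ^ m :=
    cutoffTail_le_pow (by positivity) hA₁ hp₀ m hg hgT
  have hs0 : 0 ≤ M * Real.exp (-(γ₂ / 2) * p0Profile A₁ p₀ g ^ 2) := by positivity
  have hs1 : M * Real.exp (-(γ₂ / 2) * p0Profile A₁ p₀ g ^ 2) ≤ M * g ^ m := mul_le_mul_of_nonneg_left htail hM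
  calc a ≤ (M * Real.exp (-(γ₂ / 2) * p0Profile A₁ p₀ g ^ 2)) ^ n * D := ha
    _ ≤ M * Real.exp (-(γ₂ / 2) * p0Profile A₁ p₀ g ^ 2) * D :=
        pow_mul_le_of_card_pos hs0 (hs1.trans hMg) hn hD
    _ ≤ M * g ^ m * D := mul_le_mul_of_nonneg_right hs1 hD

/-! ## §6 The one-bond Gaussian quadratic exponential moment -/

/-- **Engine for the per-bond moment constant**: for the centred real Gaussian of variance `v > 0` and `κ < 1/(2v)`,
`∫ e^{κx²} dN(0,v)(x) = (1 − 2κv)^{−1/2}` (Mathlib's `integral_gaussian`).  With [III] p. 273's spectral bound `v ≤ λ₀⁻¹`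
and `κ = ½γ₂ < ½λ₀` this is `≤ (1 − γ₂/λ₀)^{−1/2}` per bond in the diagonal caricature; the correlated many-bond moment
is the decoupling step χ.4 (NOT typed). -/
theorem integral_exp_mul_sq_gaussianReal {v : NNReal} (hv : v ≠ 0) {κ : ℝ} (hκ : κ < 1 / (2 * (v : ℝ))) :
    ∫ x, Real.exp (κ * x ^ 2) ∂(gaussianReal 0 v) = 1 / Real.sqrt (1 - 2 * κ * v) := by
  have hv0 : 0 < (v : ℝ) := by
    have : (0 : NNReal) < v := pos_iff_ne_zero.2 hv
    exact_mod_cast this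
  set b : ℝ := 1 / (2 * (v : ℝ)) - κ with hb
  have hb0 : 0 < b := by rw [hb]; linarith
  rw [integral_gaussianReal_eq_integral_smul hv]
  simp only [gaussianPDFReal_def, sub_zero, smul_eq_mul]
  have hpt : ∀ x : ℝ, (Real.sqrt (2 * Real.pi * v))⁻¹ * Real.exp (-x ^ 2 / (2 * v)) * Real.exp (κ * x ^ 2) =
      (Real.sqrt (2 * Real.pi * v))⁻¹ * Real.exp (-b * x ^ 2) := by
    intro x
    rw [mul_assoc, ← Real.exp_add]
    congr 2
    rw [hb]; field_simp; ring
  simp_rw [hpt]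
  rw [integral_const_mul, integral_gaussian b]
  have h2πv : 0 < 2 * Real.pi * v := by positivity
  have h12 : 0 < 1 - 2 * κ * v := by
    have : 2 * κ * (v : ℝ) < 1 := by
      calc 2 * κ * (v : ℝ) < 2 * (1 / (2 * (v : ℝ))) * v := by
            apply mul_lt_mul_of_pos_right _ hv0
            exact mul_lt_mul_of_pos_left hκ two_pos
        _ = 1 := by field_simp
    linarith
  rw [← Real.sqrt_inv, ← Real.sqrt_mul (inv_nonneg.2 h2πv.le), one_div, ← Real.sqrt_inv]
  congr 1
  rw [hb]; field_simp

end

end Summit.QuantumFields.BalabanUV.Beta.CutoffMayer332
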